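import Summits.QuantumFields.BalabanUV.Beta.D1BFx.StencilRealisation
import Summits.QuantumFields.BalabanUV.Beta.D1BFx.GluonKernelSectors
import Summits.QuantumFields.BalabanUV.Beta.WilsonStencilZ4

/-!
# `BalabanUV.Beta.D1BFx.WilsonStencilRealised` — road «BF-x» for binder row D1, slot (SPLIT) ∕ leaf A1.ii, part 3: THE ROAD'S WILSON (E-SECTOR)
# FINE STENCIL `GluonKernelSectors.SbE κ u = ffOf (wilsonA 3 κ u)` IS THE KERNEL REALISATION `realK u u` OF AN EXPLICIT LOCATED-PAIR LIST BUILT FROM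
# an3's `WilsonStencilZ4.wilsonStn κ 1` (colourless instance, antisymmetrised, direction-reindexed) — so its frozen-leg bubbles are an3's
# `GradedBubbles.bub` tables (`StencilRealisation.bubble_realK_realK`)

HONEST DEPENDENCY (page 1, mandatory): continuum YM on T⁴ ⇐ BetaPertH ∧ nine spine estimates (0/9 proved); BetaPertH ⇐ (D1) ∧ (D4) ∧
CAP+tail; G-an2-4 gates asym, D1 and NE2/3/4.  HONEST FRAMING (cell contract, verbatim): «discharging `BetaPertH` makes Bałaban's UV
stability UNCONDITIONAL — a real constructive-QFT result; it is NOT the continuum limit and NOT the Clay problem.»  THIS MODULE DISCHARGES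
NOTHING of the wall: [folklore] bookkeeping BY NAME over an2's `StepJetData.wEntry` ∕ `wilsonA` (the road's E-sector via leaf-05's
`GluonKernelSectors.SbE`, the typer's `FineStencilBF.ffOf`), an3's `GradedStencilDictionary.real` ∕ `lift` and `WilsonStencilZ4.real_wilsonStn` (which
hold on EVERY additive group `Λ` with decidable equality — in particular on `ℤ⁴` itself, frame `B6BondElimination.unitVec`), and this unit's
`StencilRealisation.realK`; TWO definitions with bodies ([our objects] `trStn`, `reixStn`: the transpose and the internal re-indexing of a
located-pair list; assert nothing).  No `Prop` minted, nothing printed asserted, 0 sorry.  0 wall binders; NOT D1, NOT `BetaPertH`, NOT continuum, NOT Clay.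

ABSOLUTE RULE (cell charter, verbatim): «No internally-minted statement may enter as a cited fact. Every hypothesis is either kernel-proved in
this package or a verbatim quotation of a PUBLISHED theorem with page reference. The manuscript(s) under audit are NOT citable for their own
disputed steps — they are the thing under adjudication; programme-internal (2001/route/tribunal) claims are never citable.»

WHY (skeleton v1.6 slot (SPLIT) = A0 ∘ A1.ii; parts 1–2 `FiniteStencilCalculus` p219483, `StencilRealisation`).  an2 typed the road's Wilson cubic as
ENTRIES of an3's one-bond vertex at the colourless instance on the infinite lattice (`wEntry d κ u x z α β := wilsonVertex₁ (C := Unit) unitVec u κ 1 (x,((),α)) (z,((),β))`),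
antisymmetrised (`wilsonA = ½(w − wᵀ)` on the field block).  an3 typed the SAME vertex as a located-pair LIST (`wilsonStn γ A = mainStn γ A ++ remStn γ A =
vecStn sTot ++ 2•divStn ++ remStn`) with `real e z z (wilsonStn γ A) = wilsonVertex₁ e z γ A` on every `Λ`.  THIS FILE closes the triangle on `ℤ⁴`:
`realK = real unitVec` entrywise (§1), hence `wEntry = realK (wilsonStn κ 1)` (§2), hence — with the list transpose and the `Unit × Fin 4 → Fin 4` re-indexing
(§3) — **`SbE κ u = realK u u (sbEStn κ)`** for the explicit list `sbEStn κ := ½•(reix (wilsonStn κ 1) ++ (−1)•tr (reix (wilsonStn κ 1)))` (§4).  CONSEQUENCE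
(§5, `bubble_SbE_SbE_frozen`): over the frozen fibre-diagonal leg `δ_{ab}·g (y − x)` the E×E fine bubble of the road at base bonds `(κ, u)`, `(λ, u + w)` IS
`GradedBubbles.bub g g (sbEStn κ) (sbEStn λ) (w)` — an3's table currency, in which `VecTableZ4` §3–§5 evaluate `vecStn`∕`divStn` blocks and `remStn` is
`Graded 2` (degree ≥ 7 class, A2).  REMAINING for A1.ii (part 4): the same for the LOCAL Feynman completion and the ghost current; the list algebra
`bub (½(V − Vᵀ)) (½(W − Wᵀ))` vs `bub V W` for an3's lists (antisymmetry of the colourless Wilson table under `(x,α) ↔ (z,β)`, to be decided by the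
kernel); then `VecTableZ4.three_sectors_bf_Z4` ∕ `model_table_free_eq_lattBubble_bf` and `SquareTable.stK_eq_closedForm`.
Unit `b2b-balaban-beta-d1-p2` (road owner, gen 2); `LEAVES-BFx.md` row A1.ii (part 3).
-/

open Finset
open scoped BigOperators
open Literature.MathematicalPhysics.QuantumFieldTheory.Balaban1983to89
open Literature.MathematicalPhysics.QuantumFieldTheory.Balaban1983to89.Beta
open ExpKernelCalculus (Site MKer bubble)
open DyadicShell (Pt)
open GradedBubbles (LP Stn bub smulS)
open BubbleTable (elemIns elemIns_apply)
open StepJetData (wEntry wilsonA)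
open Summit.QuantumFields.BalabanUV.Beta.GradedStencilDictionary (lift real real_nil real_cons real_append real_smulS)
open Summit.QuantumFields.BalabanUV.Beta.WilsonStencilZ4 (wilsonStn real_wilsonStn)
open Summit.QuantumFields.BalabanUV.Beta.D1BFx.FineStencilBF (ffOf ffOf_apply)
open Summit.QuantumFields.BalabanUV.Beta.D1BFx.GluonKernelSectors (SbE)
open Summit.QuantumFields.BalabanUV.Beta.D1BFx.FiniteStencilCalculus (elemK elemK_apply)
open Summit.QuantumFields.BalabanUV.Beta.D1BFx.StencilRealisation (realK realK_nil realK_cons realK_rowSupp realK_colSupp bubble_realK_realK)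

namespace Summit.QuantumFields.BalabanUV.Beta.D1BFx.WilsonStencilRealised

/-! ## §1 `realK` IS an3's `real` on `ℤ⁴` with the frame `B6BondElimination.unitVec` -/

section RealK

variable {I : Type*}

/-- [folklore] On `ℤ⁴` the frame extension of `B6BondElimination.unitVec` is the identity: `lift unitVec w = w`. -/
theorem lift_unitVec_eq (w : Pt) : lift (B6BondElimination.unitVec (d := 4)) w = w := by
  funext j
  unfold lift
  rw [Finset.sum_apply]
  simp only [Pi.smul_apply, B6BondElimination.unitVec, smul_eq_mul, mul_ite, mul_one, mul_zero, Finset.sum_ite_eq, Finset.mem_univ,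
    if_true]

/-- [folklore] **`realK` IS `real unitVec` ENTRYWISE on `ℤ⁴`**: `realK zr zc V x z a b = real unitVec zr zc V (x, a) (z, b)`. -/
theorem realK_eq_real (zr zc : Pt) (V : Stn I) (x z : Pt) (a b : I) :
    realK zr zc V x z a b = real (B6BondElimination.unitVec (d := 4)) zr zc V (x, a) (z, b) := by
  induction V with
  | nil => rw [realK_nil, real_nil]; rfl
  | cons p V ih =>
    rw [realK_cons, real_cons, Matrix.add_apply, lift_unitVec_eq, lift_unitVec_eq, elemIns_apply, ← ih]
    rfl

end RealK

/-! ## §2 an2's colourless Wilson entry IS the realisation of an3's `wilsonStn κ 1` -/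

/-- [folklore] **`wEntry 3 κ u x z α β = realK u u (wilsonStn κ 1) x z ((), α) ((), β)`** — an2's entry of an3's one-bond Wilson vertex at the
colourless instance on `ℤ⁴` is the entry of the kernel realisation, at the base bond's site `u`, of an3's located-pair list (`real_wilsonStn` on `Λ := ℤ⁴`). -/
theorem wEntry_eq_realK (κ : Fin 4) (u x z : Pt) (α β : Fin 4) :
    wEntry 3 κ u x z α β = realK u u (wilsonStn κ (1 : Matrix Unit Unit ℝ)) x z ((), α) ((), β) := by
  unfold wEntry
  rw [← real_wilsonStn (B6BondElimination.unitVec (d := 4)) u κ (1 : Matrix Unit Unit ℝ), realK_eq_real]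

/-! ## §3 Transpose and internal re-indexing of located-pair lists -/

section ListOps

variable {I J : Type*}

/-- [our object] **THE TRANSPOSE OF A LOCATED-PAIR LIST**: swap row and column sites and transpose the internal matrix.  A DEFINITION; asserts nothing. -/
def trStn (V : Stn I) : Stn I := V.map fun p => ⟨p.y, p.x, p.m.transpose⟩

/-- [our object] **THE INTERNAL RE-INDEXING OF A LOCATED-PAIR LIST** along `f : J → I`: every internal matrix `m` becomes `m.submatrix f f`.  A DEFINITION. -/
def reixStn (f : J → I) (V : Stn I) : Stn J := V.map fun p => ⟨p.x, p.y, p.m.submatrix f f⟩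

/-- [our object] Unfoldings. -/
@[simp] theorem trStn_nil : trStn ([] : Stn I) = [] := rfl
/-- [our object] Unfolding. -/
@[simp] theorem trStn_cons (p : LP I) (V : Stn I) : trStn (p :: V) = ⟨p.y, p.x, p.m.transpose⟩ :: trStn V := rfl
/-- [our object] Unfolding. -/
@[simp] theorem reixStn_nil (f : J → I) : reixStn f ([] : Stn I) = [] := rfl
/-- [our object] Unfolding. -/
@[simp] theorem reixStn_cons (f : J → I) (p : LP I) (V : Stn I) : reixStn f (p :: V) = ⟨p.x, p.y, p.m.submatrix f f⟩ :: reixStn f V := rfl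

/-- [folklore] **THE TRANSPOSED LIST REALISES THE TRANSPOSED KERNEL** (base points swapped): `realK zr zc (trStn V) x z a b = realK zc zr V z x b a`. -/
theorem realK_trStn (zr zc : Pt) (V : Stn I) (x z : Pt) (a b : I) :
    realK zr zc (trStn V) x z a b = realK zc zr V z x b a := by
  induction V with
  | nil => rfl
  | cons p V ih =>
    simp only [trStn_cons, realK_cons, Pi.add_apply, ih, elemK_apply, Matrix.transpose_apply]
    congr 1
    by_cases h : x = zr + p.y ∧ z = zc + p.x
    · rw [if_pos h, if_pos ⟨h.2, h.1⟩]
    · rw [if_neg h, if_neg fun h' => h ⟨h'.2, h'.1⟩]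

/-- [folklore] **THE RE-INDEXED LIST REALISES THE RE-INDEXED KERNEL**: `realK zr zc (reixStn f V) x z a b = realK zr zc V x z (f a) (f b)`. -/
theorem realK_reixStn (f : J → I) (zr zc : Pt) (V : Stn I) (x z : Pt) (a b : J) :
    realK zr zc (reixStn f V) x z a b = realK zr zc V x z (f a) (f b) := by
  induction V with
  | nil => rfl
  | cons p V ih =>
    simp only [reixStn_cons, realK_cons, Pi.add_apply, ih, elemK_apply, Matrix.submatrix_apply]

/-- [folklore] `realK` of an appended list is the sum. -/
theorem realK_append (zr zc : Pt) (V W : Stn I) : realK zr zc (V ++ W) = realK zr zc V + realK zr zc W := by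
  induction V with
  | nil => rw [List.nil_append, realK_nil, zero_add]
  | cons p V ih => rw [List.cons_append, realK_cons, realK_cons, ih, add_assoc]

/-- [folklore] `realK` of a scaled list is the scaled kernel. -/
theorem realK_smulS (zr zc : Pt) (c : ℝ) (V : Stn I) : realK zr zc (smulS c V) = c • realK zr zc V := by
  induction V with
  | nil => rw [smulS, List.map_nil, realK_nil, smul_zero]
  | cons p V ih =>
    have e : smulS c (p :: V) = ⟨p.x, p.y, c • p.m⟩ :: smulS c V := rfl
    rw [e, realK_cons, realK_cons, ih, smul_add]
    congr 1
    funext x z a b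
    simp only [elemK_apply, Pi.smul_apply, Matrix.smul_apply, smul_eq_mul, mul_ite, mul_zero]

end ListOps

/-! ## §4 The road's E-sector stencil as a realised list -/

/-- [our object] The internal re-indexing `Fin 4 → Unit × Fin 4` of the colourless instance. -/
abbrev ιU : Fin 4 → Unit × Fin 4 := fun α => ((), α)

/-- [our object] **THE E-SECTOR LIST**: `sbEStn κ := ½ • (reix (wilsonStn κ 1) ++ (−1) • tr (reix (wilsonStn κ 1)))` — an3's Wilson one-bond list at the
colourless instance, direction-reindexed and ANTISYMMETRISED as an2's `wilsonA` prescribes.  A DEFINITION; asserts nothing. -/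
noncomputable def sbEStn (κ : Fin 4) : Stn (Fin 4) :=
  smulS (1 / 2) (reixStn ιU (wilsonStn κ (1 : Matrix Unit Unit ℝ)) ++ smulS (-1) (trStn (reixStn ιU (wilsonStn κ (1 : Matrix Unit Unit ℝ)))))

/-- [folklore] **THE ROAD'S WILSON FINE STENCIL IS A REALISED LIST**: `SbE κ u = realK u u (sbEStn κ)` as fine kernels `MKer 4 (Fin 4)` — by an2's
definition of `wilsonA` (`½(w(x,α;z,β) − w(z,β;x,α))` on the field block), §2 and §3. -/
theorem SbE_eq_realK (κ : Fin 4) (u : Pt) : SbE κ u = realK u u (sbEStn κ) := by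
  funext x z α β
  rw [sbEStn, realK_smulS, realK_append, realK_smulS, Pi.smul_apply, Pi.smul_apply, Pi.smul_apply, Pi.smul_apply, Pi.add_apply,
    Pi.add_apply, Pi.add_apply, Pi.add_apply, Pi.smul_apply, Pi.smul_apply, Pi.smul_apply, Pi.smul_apply, realK_trStn, realK_reixStn,
    realK_reixStn, ← wEntry_eq_realK, ← wEntry_eq_realK]
  show ffOf (wilsonA 3 κ u) x z α β = _
  rw [ffOf_apply]
  show (1 / 2 : ℝ) * (wEntry 3 κ u x z α β - wEntry 3 κ u z x β α) = _
  simp only [smul_eq_mul]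
  ring

/-! ## §5 Consequence: the E×E fine bubble over a frozen leg is an3's table -/

/-- [folklore] **THE E×E FINE BUBBLE OF THE ROAD OVER A FROZEN FIBRE-DIAGONAL LEG IS an3's `ℤ⁴` TABLE**: for `A x y a b = δ_{ab}·g (y − x)` and base
bonds `(κ, u)`, `(λ, u + w)`: `bubble A (SbE κ u) (SbE λ (u + w)) = bub g g (sbEStn κ) (sbEStn λ) L k w` (every dummy `L k`). -/
theorem bubble_SbE_SbE_frozen (g : Pt → ℝ) {A : MKer 4 (Fin 4)} (hA : ∀ x y a b, A x y a b = if a = b then g (y - x) else 0)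
    (κ lam : Fin 4) (u w : Pt) (L k : ℕ) :
    bubble A (SbE κ u) (SbE lam (u + w)) = bub (fun _ _ => g) (fun _ _ => g) (sbEStn κ) (sbEStn lam) L k w := by
  rw [SbE_eq_realK, SbE_eq_realK]
  exact bubble_realK_realK g hA (sbEStn κ) (sbEStn lam) u w L k

end Summit.QuantumFields.BalabanUV.Beta.D1BFx.WilsonStencilRealised
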